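import Literature.Analysis.FluidPDE.TaoY6Poincare
import HarnessLib

/-!
# One step of the Whitney chain: comparison of averages on two overlapping balls in `ℝ³`

Analysis/FluidPDE support file for the discharge of the named fact
`Literature.Analysis.FluidPDE.tao2011_nonlinearEstimate` (Tao 2011, §10, proof of Thm. 10.1,
estimate of `Y₆`, arXiv:1108.1165 p. 33): "for any small ball `Bᵢ`, we may assign a "parent" ball
`B_{p(i)}` which touches the ball but has radius at least `1.001` (say) as large as that of `Bᵢ`
[…] `|wᵢ - wⱼ| ≲ rᵢ^{-1/2} (∫_{10Bᵢ} |∇ω|²)^{1/2}` whenever `Bᵢ, Bⱼ` intersect" (from the Poincaré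
inequality). Here the chain is laid out explicitly along a ray: the step from the ball
`B = B(c, t/4)` to its parent `B' = B(c + (t/2)v, 3t/8)` (`|v| = 1`; the parent sits at depth
`3t/2` when `c` sits at depth `t`). The two balls contain the common ball
`D = B(c + (3t/16)v, t/20)`, the union `B ∪ B'` is star-shaped with respect to `B ∩ B'`, and the
real square-form Poincaré inequality of `FluidPDE/TaoY6Poincare` gives

  `‖⨍_B f − ⨍_{B'} f‖² ≤ C_step (v₁ t)⁻¹ ∫_{B ∪ B'} ‖Df‖²`,  `v₁ = |B(0,1)|`, `C_step = 630144`

(`sq_norm_setAverage_ball_sub_parent_le`), together with the volume bookkeeping for balls in `ℝ³`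
and the one-ball Poincaré/Jensen facts used at the two ends of the chain.

## References

* T. Tao, arXiv:1108.1165 (`Tao2011`), §10, proof of Thm. 10.1, p. 33 (parent balls, (10.24)).
* V. G. Maz'ja, *Sobolev Spaces* (1985), §1.1.11.
-/

noncomputable section

open MeasureTheory Set Filter Metric Function
open scoped ENNReal NNReal

namespace Literature.Analysis.FluidPDE.TaoY6

variable {F : Type*} [NormedAddCommGroup F] [NormedSpace ℝ F] [CompleteSpace F]

/-! ### Volumes of balls in `ℝ³` -/

/-- `|B(x, ρ)| = ρ³ |B(0, 1)|` in `ℝ³` (real-valued). [folklore] -/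
theorem volumeReal_ball_eq (x : EuclideanSpace ℝ (Fin 3)) {ρ : ℝ} (hρ : 0 ≤ ρ) :
    (volume : Measure (EuclideanSpace ℝ (Fin 3))).real (ball x ρ) =
      ρ ^ 3 * (volume : Measure (EuclideanSpace ℝ (Fin 3))).real (ball 0 1) := by
  rw [measureReal_def, measureReal_def, Measure.addHaar_ball volume x hρ,
    finrank_euclideanSpace_fin, ENNReal.toReal_mul, ENNReal.toReal_ofReal (pow_nonneg hρ 3)]

/-- `0 < |B(0, 1)| < ∞` in `ℝ³` (real-valued volume is positive). [folklore] -/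
theorem volumeReal_unitBall_pos :
    0 < (volume : Measure (EuclideanSpace ℝ (Fin 3))).real (ball 0 1) :=
  ENNReal.toReal_pos (measure_ball_pos volume _ one_pos).ne' measure_ball_lt_top.ne

/-- Balls have positive, finite measure: `μ B(x, ρ) ≠ 0` for `ρ > 0`. [folklore] -/
theorem volume_ball_ne_zero (x : EuclideanSpace ℝ (Fin 3)) {ρ : ℝ} (hρ : 0 < ρ) :
    (volume : Measure (EuclideanSpace ℝ (Fin 3))) (ball x ρ) ≠ 0 :=
  (measure_ball_pos volume x hρ).ne'

/-! ### An elementary inequality -/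

omit [NormedSpace ℝ F] [CompleteSpace F] in
/-- `‖a − b‖² ≤ 2‖a − m‖² + 2‖b − m‖²`. [folklore] -/
theorem norm_sub_sq_le_two_mul_add (a b m : F) :
    ‖a - b‖ ^ 2 ≤ 2 * ‖a - m‖ ^ 2 + 2 * ‖b - m‖ ^ 2 := by
  have h : ‖a - b‖ ≤ ‖a - m‖ + ‖b - m‖ := by
    calc ‖a - b‖ = ‖(a - m) - (b - m)‖ := by abel_nf
      _ ≤ ‖a - m‖ + ‖b - m‖ := norm_sub_le _ _
  nlinarith [norm_nonneg (a - b), norm_nonneg (a - m), norm_nonneg (b - m), sq_nonneg (‖a - m‖ - ‖b - m‖)]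

omit [NormedSpace ℝ F] [CompleteSpace F] in
/-- `‖a‖² ≤ 2‖a − m‖² + 2‖m‖²`. [folklore] -/
theorem norm_sq_le_two_mul_add (a m : F) : ‖a‖ ^ 2 ≤ 2 * ‖a - m‖ ^ 2 + 2 * ‖m‖ ^ 2 := by
  have h := norm_sub_sq_le_two_mul_add a 0 m
  simpa using h

/-! ### The two-ball step -/

section Step

variable {f : EuclideanSpace ℝ (Fin 3) → F} {t : ℝ} {c v : EuclideanSpace ℝ (Fin 3)}

/-- The common ball `D = B(c + (3t/16)v, t/20)` lies in `B(c, t/4)`. [folklore] -/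
theorem commonBall_subset_left (ht : 0 < t) (hv : ‖v‖ = 1) :
    ball (c + (3 * t / 16) • v) (t / 20) ⊆ ball c (t / 4) := by
  intro z hz
  rw [mem_ball] at hz ⊢
  have h1 : dist (c + (3 * t / 16) • v) c = 3 * t / 16 := by
    rw [dist_eq_norm, add_sub_cancel_left, norm_smul, hv, mul_one, Real.norm_eq_abs,
      abs_of_pos (by positivity)]
  calc dist z c ≤ dist z (c + (3 * t / 16) • v) + dist (c + (3 * t / 16) • v) c :=
        dist_triangle _ _ _
    _ < t / 20 + 3 * t / 16 := by rw [h1]; linarith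
    _ ≤ t / 4 := by linarith

/-- The common ball `D` lies in the parent `B(c + (t/2)v, 3t/8)`. [folklore] -/
theorem commonBall_subset_right (ht : 0 < t) (hv : ‖v‖ = 1) :
    ball (c + (3 * t / 16) • v) (t / 20) ⊆ ball (c + (t / 2) • v) (3 * t / 8) := by
  intro z hz
  rw [mem_ball] at hz ⊢
  have h1 : dist (c + (3 * t / 16) • v) (c + (t / 2) • v) = 5 * t / 16 := by
    rw [dist_eq_norm, add_sub_add_left_eq_sub, ← sub_smul, norm_smul, hv, mul_one,
      Real.norm_eq_abs, show 3 * t / 16 - t / 2 = -(5 * t / 16) by ring, abs_neg,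
      abs_of_pos (by positivity)]
  calc dist z (c + (t / 2) • v)
      ≤ dist z (c + (3 * t / 16) • v) + dist (c + (3 * t / 16) • v) (c + (t / 2) • v) :=
        dist_triangle _ _ _
    _ < t / 20 + 5 * t / 16 := by rw [h1]; linarith
    _ ≤ 3 * t / 8 := by linarith

/-- **The two-ball step of the chain** (Tao's "`|wᵢ − w_{p(i)}| ≲ rᵢ^{-1/2}(∫|∇ω|²)^{1/2}`",
p. 33, in mean form): for `f ∈ C¹(ℝ³; F)`, `t > 0`, a centre `c` and a unit vector `v`,
`‖⨍_{B(c,t/4)} f − ⨍_{B(c+(t/2)v, 3t/8)} f‖² ≤ 630144 (|B(0,1)| t)⁻¹ ∫_{B ∪ B'} ‖Df‖²`. [cite: Tao2011, §10, proof of Thm. 10.1 (p. 33, (10.24))] -/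
theorem sq_norm_setAverage_ball_sub_parent_le (hf : ContDiff ℝ 1 f) (ht : 0 < t) (hv : ‖v‖ = 1) :
    ‖(⨍ x in ball c (t / 4), f x) - ⨍ x in ball (c + (t / 2) • v) (3 * t / 8), f x‖ ^ 2 ≤
      630144 / ((volume : Measure (EuclideanSpace ℝ (Fin 3))).real (ball 0 1) * t) *
        ∫ x in ball c (t / 4) ∪ ball (c + (t / 2) • v) (3 * t / 8), ‖fderiv ℝ f x‖ ^ 2 := by
  set B₁ : Set (EuclideanSpace ℝ (Fin 3)) := ball c (t / 4) with hB₁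
  set B₂ : Set (EuclideanSpace ℝ (Fin 3)) := ball (c + (t / 2) • v) (3 * t / 8) with hB₂
  set D : Set (EuclideanSpace ℝ (Fin 3)) := ball (c + (3 * t / 16) • v) (t / 20) with hD
  set vol : ℝ := (volume : Measure (EuclideanSpace ℝ (Fin 3))).real (ball 0 1) with hvol
  have hvol0 : 0 < vol := volumeReal_unitBall_pos
  have hD1 : D ⊆ B₁ := commonBall_subset_left ht hv
  have hD2 : D ⊆ B₂ := commonBall_subset_right ht hv
  -- geometry of the union `A = B₁ ∪ B₂` and the intersection `B₁ ∩ B₂`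
  have hA : IsOpen (B₁ ∪ B₂) := isOpen_ball.union isOpen_ball
  have hAb : Bornology.IsBounded (B₁ ∪ B₂) := isBounded_ball.union isBounded_ball
  have hBi : MeasurableSet (B₁ ∩ B₂) := measurableSet_ball.inter measurableSet_ball
  have hBiA : B₁ ∩ B₂ ⊆ B₁ ∪ B₂ := fun z hz => Or.inl hz.1
  have hseg : ∀ x ∈ B₁ ∪ B₂, ∀ y ∈ B₁ ∩ B₂, segment ℝ x y ⊆ B₁ ∪ B₂ := by
    intro x hx y hy
    rcases hx with hx | hx
    · exact ((convex_ball c (t / 4)).segment_subset hx hy.1).trans subset_union_left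
    · exact ((convex_ball _ _).segment_subset hx hy.2).trans subset_union_right
  have hδ : ∀ x ∈ B₁ ∪ B₂, ∀ y ∈ B₁ ∩ B₂, ‖y - x‖ ≤ 3 * t / 4 := by
    intro x hx y hy
    rw [← dist_eq_norm]
    rcases hx with hx | hx
    · have h1 := mem_ball.1 hx; have h2 := mem_ball.1 hy.1
      linarith [dist_triangle_right y x c]
    · have h1 := mem_ball.1 hx; have h2 := mem_ball.1 hy.2
      linarith [dist_triangle_right y x (c + (t / 2) • v)]
  have hδ0 : 0 < 3 * t / 4 := by positivity
  have hBi0 : volume (B₁ ∩ B₂) ≠ 0 := fun h0 =>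
    volume_ball_ne_zero (c + (3 * t / 16) • v) (by positivity : 0 < t / 20)
      (measure_mono_null (subset_inter hD1 hD2) h0)
  -- the two comparisons with the mean over `B₁ ∩ B₂`
  have h1 := sq_norm_setAverage_sub_setAverage_le (μ := volume) hf hA hAb hBi hBiA hseg hδ0 hδ
    hBi0 subset_union_left (volume_ball_ne_zero c (by positivity : 0 < t / 4))
  have h2 := sq_norm_setAverage_sub_setAverage_le (μ := volume) hf hA hAb hBi hBiA hseg hδ0 hδ
    hBi0 subset_union_right (volume_ball_ne_zero _ (by positivity : 0 < 3 * t / 8))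
  rw [finrank_euclideanSpace_fin] at h1 h2
  -- volume bookkeeping
  set G : ℝ := ∫ x in B₁ ∪ B₂, ‖fderiv ℝ f x‖ ^ 2 with hG
  have hG0 : 0 ≤ G := integral_nonneg fun _ => sq_nonneg _
  have hvB₁ : (volume : Measure (EuclideanSpace ℝ (Fin 3))).real B₁ = (t / 4) ^ 3 * vol :=
    volumeReal_ball_eq c (by positivity)
  have hvB₂ : (volume : Measure (EuclideanSpace ℝ (Fin 3))).real B₂ = (3 * t / 8) ^ 3 * vol :=
    volumeReal_ball_eq _ (by positivity)
  have hvD : (volume : Measure (EuclideanSpace ℝ (Fin 3))).real D = (t / 20) ^ 3 * vol :=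
    volumeReal_ball_eq _ (by positivity)
  have hAt : volume (B₁ ∪ B₂) ≠ ∞ := hAb.measure_lt_top.ne
  have hvA : (volume : Measure (EuclideanSpace ℝ (Fin 3))).real (B₁ ∪ B₂) ≤
      (t / 4) ^ 3 * vol + (3 * t / 8) ^ 3 * vol := by
    rw [← hvB₁, ← hvB₂]; exact measureReal_union_le _ _
  have hvBi : (t / 20) ^ 3 * vol ≤ (volume : Measure (EuclideanSpace ℝ (Fin 3))).real (B₁ ∩ B₂) := by
    rw [← hvD]
    exact measureReal_mono (subset_inter hD1 hD2) (measure_ne_top_of_subset hBiA hAt)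
  have hBir : 0 < (volume : Measure (EuclideanSpace ℝ (Fin 3))).real (B₁ ∩ B₂) :=
    lt_of_lt_of_le (by positivity) hvBi
  -- the ratio `|A| / |B₁ ∩ B₂| ≤ 547`
  have hratio : (volume : Measure (EuclideanSpace ℝ (Fin 3))).real (B₁ ∪ B₂) /
      (volume : Measure (EuclideanSpace ℝ (Fin 3))).real (B₁ ∩ B₂) ≤ 547 := by
    rw [div_le_iff₀ hBir]
    have : (t / 4) ^ 3 * vol + (3 * t / 8) ^ 3 * vol ≤ 547 * ((t / 20) ^ 3 * vol) := by
      nlinarith [mul_pos (pow_pos ht 3) hvol0]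
    linarith
  have hX : 2 ^ 3 * (3 * t / 4) ^ 2 *
      ((volume : Measure (EuclideanSpace ℝ (Fin 3))).real (B₁ ∪ B₂) /
        (volume : Measure (EuclideanSpace ℝ (Fin 3))).real (B₁ ∩ B₂)) * G ≤
      2 ^ 3 * (3 * t / 4) ^ 2 * 547 * G := by
    gcongr
  -- first comparison
  have h1' : ‖(⨍ x in B₁, f x) - ⨍ y in B₁ ∩ B₂, f y‖ ^ 2 ≤ 157536 * G / (vol * t) := by
    refine h1.trans ?_
    rw [hvB₁]
    calc ((t / 4) ^ 3 * vol)⁻¹ * (2 ^ 3 * (3 * t / 4) ^ 2 *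
          ((volume : Measure (EuclideanSpace ℝ (Fin 3))).real (B₁ ∪ B₂) /
            (volume : Measure (EuclideanSpace ℝ (Fin 3))).real (B₁ ∩ B₂)) * G)
        ≤ ((t / 4) ^ 3 * vol)⁻¹ * (2 ^ 3 * (3 * t / 4) ^ 2 * 547 * G) :=
          mul_le_mul_of_nonneg_left hX (by positivity)
      _ = 157536 * G / (vol * t) := by field_simp; ring
  -- second comparison (the parent ball is larger, so its inverse volume is smaller)
  have h2' : ‖(⨍ x in B₂, f x) - ⨍ y in B₁ ∩ B₂, f y‖ ^ 2 ≤ 157536 * G / (vol * t) := by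
    refine h2.trans ?_
    rw [hvB₂]
    have hinv : ((3 * t / 8) ^ 3 * vol)⁻¹ ≤ ((t / 4) ^ 3 * vol)⁻¹ := by
      apply inv_anti₀ (by positivity)
      nlinarith [mul_pos (pow_pos ht 3) hvol0]
    calc ((3 * t / 8) ^ 3 * vol)⁻¹ * (2 ^ 3 * (3 * t / 4) ^ 2 *
          ((volume : Measure (EuclideanSpace ℝ (Fin 3))).real (B₁ ∪ B₂) /
            (volume : Measure (EuclideanSpace ℝ (Fin 3))).real (B₁ ∩ B₂)) * G)
        ≤ ((t / 4) ^ 3 * vol)⁻¹ * (2 ^ 3 * (3 * t / 4) ^ 2 * 547 * G) :=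
          mul_le_mul hinv hX (by positivity) (by positivity)
      _ = 157536 * G / (vol * t) := by field_simp; ring
  -- combine
  calc ‖(⨍ x in B₁, f x) - ⨍ x in B₂, f x‖ ^ 2
      ≤ 2 * ‖(⨍ x in B₁, f x) - ⨍ y in B₁ ∩ B₂, f y‖ ^ 2 +
          2 * ‖(⨍ x in B₂, f x) - ⨍ y in B₁ ∩ B₂, f y‖ ^ 2 := norm_sub_sq_le_two_mul_add _ _ _
    _ ≤ 2 * (157536 * G / (vol * t)) + 2 * (157536 * G / (vol * t)) := by linarith
    _ = 630144 / (vol * t) * G := by ring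

end Step

/-! ### The two ends of the chain: one-ball Poincaré and Jensen -/

section Ends

variable {f : EuclideanSpace ℝ (Fin 3) → F}

/-- **Poincaré on a single ball, mass form**: `∫_B ‖f‖² ≤ 4ρ² ∫_B ‖Df‖² + 2|B| ‖⨍_B f‖²`
for `B = B(c, ρ)` (`‖f‖² ≤ 2‖f − ⨍f‖² + 2‖⨍f‖²` and `∫_B‖f − ⨍_B f‖² ≤ 8ρ²∫_B‖Df‖²`). [folklore] -/
theorem setIntegral_ball_sq_norm_le (hf : ContDiff ℝ 1 f) (c : EuclideanSpace ℝ (Fin 3)) {ρ : ℝ}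
    (hρ : 0 < ρ) :
    ∫ x in ball c ρ, ‖f x‖ ^ 2 ≤ 64 * ρ ^ 2 * (∫ x in ball c ρ, ‖fderiv ℝ f x‖ ^ 2) +
      2 * (volume : Measure (EuclideanSpace ℝ (Fin 3))).real (ball c ρ) *
        ‖⨍ x in ball c ρ, f x‖ ^ 2 := by
  have hBb : Bornology.IsBounded (ball c ρ) := isBounded_ball
  have hBt : volume (ball c ρ) ≠ ∞ := hBb.measure_lt_top.ne
  haveI : IsFiniteMeasure ((volume : Measure (EuclideanSpace ℝ (Fin 3))).restrict (ball c ρ)) :=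
    isFiniteMeasure_restrict.2 hBt
  have hBr : 0 < (volume : Measure (EuclideanSpace ℝ (Fin 3))).real (ball c ρ) :=
    ENNReal.toReal_pos (volume_ball_ne_zero c hρ) hBt
  have hfc : Continuous f := hf.continuous
  -- Poincaré on `B` with respect to itself
  have hP := setIntegral_sq_norm_sub_setAverage_le (μ := volume) hf isOpen_ball hBb
    measurableSet_ball subset_rfl
    (fun x hx y hy => (convex_ball c ρ).segment_subset hx hy) (by positivity : 0 < 2 * ρ)
    (fun x hx y hy => by
      rw [← dist_eq_norm]
      linarith [dist_triangle_right y x c, mem_ball.1 hx, mem_ball.1 hy])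
    (volume_ball_ne_zero c hρ)
  rw [finrank_euclideanSpace_fin, div_self hBr.ne', mul_one] at hP
  -- integrate the pointwise inequality `‖f‖² ≤ 2‖f − m‖² + 2‖m‖²`
  have hI1 : IntegrableOn (fun x => ‖f x - ⨍ y in ball c ρ, f y‖ ^ 2) (ball c ρ) volume :=
    integrableOn_of_continuous_of_isBounded ((hfc.sub continuous_const).norm.pow 2) hBb
  have hI0 : IntegrableOn (fun x => ‖f x‖ ^ 2) (ball c ρ) volume :=
    integrableOn_of_continuous_of_isBounded (hfc.norm.pow 2) hBb
  have hIc : IntegrableOn (fun _ : EuclideanSpace ℝ (Fin 3) => 2 * ‖⨍ y in ball c ρ, f y‖ ^ 2)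
      (ball c ρ) volume := integrableOn_const (by simpa using hBt)
  calc ∫ x in ball c ρ, ‖f x‖ ^ 2
      ≤ ∫ x in ball c ρ, (2 * ‖f x - ⨍ y in ball c ρ, f y‖ ^ 2 + 2 * ‖⨍ y in ball c ρ, f y‖ ^ 2) :=
        setIntegral_mono_on hI0 (by exact (hI1.const_mul 2).add hIc) measurableSet_ball
          fun x _ => norm_sq_le_two_mul_add (f x) _
    _ = 2 * (∫ x in ball c ρ, ‖f x - ⨍ y in ball c ρ, f y‖ ^ 2) + 2 * ‖⨍ y in ball c ρ, f y‖ ^ 2 *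
          (volume : Measure (EuclideanSpace ℝ (Fin 3))).real (ball c ρ) := by
        rw [integral_add (hI1.const_mul 2) hIc, integral_const_mul, setIntegral_const, smul_eq_mul]
        ring
    _ ≤ 2 * (2 ^ 3 * (2 * ρ) ^ 2 * ∫ x in ball c ρ, ‖fderiv ℝ f x‖ ^ 2) +
          2 * ‖⨍ y in ball c ρ, f y‖ ^ 2 *
            (volume : Measure (EuclideanSpace ℝ (Fin 3))).real (ball c ρ) := by linarith
    _ = 64 * ρ ^ 2 * (∫ x in ball c ρ, ‖fderiv ℝ f x‖ ^ 2) +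
          2 * (volume : Measure (EuclideanSpace ℝ (Fin 3))).real (ball c ρ) *
            ‖⨍ x in ball c ρ, f x‖ ^ 2 := by ring

omit [CompleteSpace F] in
/-- **Jensen on a ball**: `|B| ‖⨍_B f‖² ≤ ∫_B ‖f‖²`. [folklore] -/
theorem volumeReal_mul_sq_norm_setAverage_ball_le (hf : Continuous f)
    (c : EuclideanSpace ℝ (Fin 3)) {ρ : ℝ} (hρ : 0 < ρ) :
    (volume : Measure (EuclideanSpace ℝ (Fin 3))).real (ball c ρ) * ‖⨍ x in ball c ρ, f x‖ ^ 2 ≤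
      ∫ x in ball c ρ, ‖f x‖ ^ 2 := by
  have hBt : volume (ball c ρ) ≠ ∞ := isBounded_ball.measure_lt_top.ne
  have hBr : 0 < (volume : Measure (EuclideanSpace ℝ (Fin 3))).real (ball c ρ) :=
    ENNReal.toReal_pos (volume_ball_ne_zero c hρ) hBt
  have hJ := sq_norm_setAverage_le_inv_mul_setIntegral (μ := volume) hBt hf.aestronglyMeasurable
    (integrableOn_of_continuous_of_isBounded (hf.norm.pow 2) isBounded_ball)
  calc (volume : Measure (EuclideanSpace ℝ (Fin 3))).real (ball c ρ) * ‖⨍ x in ball c ρ, f x‖ ^ 2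
      ≤ (volume : Measure (EuclideanSpace ℝ (Fin 3))).real (ball c ρ) *
          (((volume : Measure (EuclideanSpace ℝ (Fin 3))).real (ball c ρ))⁻¹ *
            ∫ x in ball c ρ, ‖f x‖ ^ 2) := mul_le_mul_of_nonneg_left hJ hBr.le
    _ = ∫ x in ball c ρ, ‖f x‖ ^ 2 := by field_simp

end Ends

end Literature.Analysis.FluidPDE.TaoY6

end
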